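/-
Copyright (c) 2026. All rights reserved.
Released under Apache 2.0 license as described in the file LICENSE.
Authors: HodgeCM publication cell (pub-hodgecm), model-construction sub-cell, construction prover `mc-unitary-2`.
-/
import Literature.NumberTheory.Automorphic.UnitaryGroupSymplecticRationalPoints
import HarnessLib

/-!
# The see-saw conjugation element: a rational hermitian isometry `g : (V, h′) ≅ (V, h)` as an element
`h₀ = Res(g) ∘ Λ_C⁻¹ ∈ Sp(W_T)` and the square `h₀ · (Λ_C ι′(u′) Λ_C⁻¹) · h₀⁻¹ = ι(g u′ g⁻¹)`

Topic `NumberTheory/Automorphic`; namespace `Literature.NumberTheory.Automorphic.UnitaryGroup` (sixth part of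
`UnitaryGroupSymplecticEmbedding`). Definitions and proved lemmas only: **no named facts, 0 proof holes**.

**Setting (pure algebra, §1–§4).** Quadratic coordinates `h : IsQuadraticCoordinates φ Ψ δ d` (`S = φ(R) ⊕ φ(R) δ`),
the conjugation `σ` (`σ ∘ φ = φ`, `σ δ = -δ`), and TWO `R`-rational Gram matrices `T, T′ ∈ Sym_n(R)` of hermitian form
matrices `H = T ⊗ 1`, `H′ = T′ ⊗ 1` on the same `Sⁿ` — the model is a hermitian space `(V, h)` and a second hermitian
structure `(V, h′)` isometric to it, e.g. an orthogonal decomposition `W ≅ W₃ ⊕ W₄` read in a fixed basis, or the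
tensor product `V ⊗ (W₃ ⊕ W₄) ≅ V ⊗ W` through `1_V ⊗ g` (§4).  An ISOMETRY `g ∈ GLₙ(S)`, `(σ g)ᵀ H g = H′`
(`h(g x, g y) = h′(x, y)`, §1), acts on the restriction of scalars `W = Rⁿ × Rⁿ` by `Res(g) = resAut g`
(`UnitaryGroupSymplecticEmbedding` §3) and carries the alternating form `im h′ = ⟪ , ⟫_{T′}` to `im h = ⟪ , ⟫_T`
(`alt_polar_resAut`, §2) — it is a symplectic ISOMORPHISM `W_{T′} ≅ W_T`, but in general NOT compatible with the
polarised cocycles `polar β_{T′}`, `polar β_T` themselves.  The RELABELLING `Λ_C : (x, y) ↦ (x, C y)` for `C ∈ GLₙ(R)`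
with `T C = T′` (`relabelEquiv`, §2; the same formula as `Weil1964/AdelicMetaplecticTransport.relabelVec`, to which it
is definitionally equal on the adelic carrier) IS `polar`-compatible, `polar β_T (Λ_C v) (Λ_C w) = polar β_{T′} v w`.
Hence the composite

  **`seesawConj g C := Res(g) ∘ Λ_C⁻¹ ∈ symplecticGroup (polar β_T) = Sp(W_T)`** (§2)

is an honest ELEMENT of the one symplectic group `Sp(W_T)` on which the tree's Heisenberg group, Schrödinger model and
metaplectic group of the Gram matrix `T` live, and (§3, the see-saw square)

  **`seesawConj · (Λ_C ∘ ι′(u′) ∘ Λ_C⁻¹) · seesawConj⁻¹ = ι(g u′ g⁻¹)`** for `u′ ∈ U(σ, H′)`,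

where `ι = toSymplectic : U(σ, H) →* Sp(W_T)`, `ι′ : U(σ, H′) →* Sp(W_{T′})` are the embeddings of
`UnitaryGroupSymplecticEmbedding` §5, `Λ_C ∘ · ∘ Λ_C⁻¹ = symplecticGroupCongr Λ_C : Sp(W_{T′}) →* Sp(W_T)`
(`UnitaryGroupSymplecticCarriers` §7) and `u′ ↦ g u′ g⁻¹ = isometryConj g : U(σ, H′) →* U(σ, H)` (§1).  §4 is the
Kronecker instance `g ↦ 1_V ⊗ g`, `u′ = v ⊗ u ↦ v ⊗ (g u g⁻¹)` (mixed-product rule): conjugation by `h₀` FIXES the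
first member `ι(v ⊗ 1)` of the dual pair and conjugates the second.

**§5 (number fields).** For a CM / quadratic extension `E/F` (`c ∈ Aut(E/F)`, `c δ = -δ`), RATIONAL data — Gram matrices
`T₀, T₀′ ∈ Sym_ι(F)` with `det T₀ ≠ 0`, an isometry `g₀ ∈ GL_ι(E)` and `C₀ ∈ GL_ι(F)` — and their images `g`, `C` over
`𝔸_E = 𝔸_F ⊕ 𝔸_F δ` (`isQuadraticCoordinates_adele`): the adelic `seesawConj g C` EXTENDS the rational
`seesawConj g₀ C₀` on `F`-rational vectors (`seesawConj_adele_apply_algebraMap`), hence is an `F`-RATIONAL POINT of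
`Sp(W_T)(𝔸_F)` in the sense of record — **`seesawConj_adele_mem_range`**:
`seesawConj g C ∈ ((transportSp (T₀.map ι) hT).comp (mapHom ι)).range`, `ι = algebraMap F 𝔸_F`
(`UnitaryGroupSymplecticRationalPoints.SpTransport.mem_range_transportSp_mapHom`); the adelic Grams enter through
equation parameters `hTT₀ : T = T₀.map ι` (so `T_V.map ι ⊗ₖ T_W.map ι` with `T₀ = T_V ⊗ₖ T_W` feeds in by
`kronecker_map_map`).  This is the only input Weil's `Θ`-fixing rational lift needs to absorb `h₀` inside ONE
metaplectic group ([Weil1964, Chap. III n° 41 Thm 6 p. 193]; the lift itself is NOT in this file).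

**§6 (the adelic unitary dual pair, index `Fin N × Fin M`, vocabulary of `UnitaryGroupSymplecticCarriers` /
`UnitaryGroupDualPairCarriers`).** `adelicIsometryConj g hg : adelic F E c M J_W′ →* adelic F E c M J_W`;
**`adelicSeesawConj … g hg C hC : symplecticGroup (polar (toLinearMap₂' 𝔸_F (T_V.map ι ⊗ₖ T_W.map ι)))`** — the same
symplectic group as the targets of `adelicDualPairToSymplectic` / `adelicPairToSymplectic`; the square
**`adelicSeesawConj_conj`** (`h₀ · (Λ_C toSp′(v ⊗ u′) Λ_C⁻¹) · h₀⁻¹ = toSp(v ⊗ g u′ g⁻¹)`, also `_dualPair`); and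
**`adelicSeesawConj_mem_range`**: for rational data `g = g₀ ⊗ 1`, `C = C₀ ⊗ 1`,
`adelicSeesawConj g C ∈ ((transportSp (T_V.map ι ⊗ₖ T_W.map ι) hT).comp (mapHom ι)).range`.

Context: the see-saw of dual pairs `(U(V) × U(V), U(W₃) × U(W₄)) ↔ (U(V), U(W))` [Kudla1984, §1],
[GelbartRogawski1991, §3.2], in the coordinates of [MoeglinVignerasWaldspurger1987, Ch. 1 I.17–I.19].  Everything here
is coefficientwise linear algebra over commutative rings; kernel only; `[folklore]` unless tagged.

## Mathlib / tree

Mathlib: `Matrix.toLinearMap₂'_apply'`, `RingHom.map_mulVec`, `Matrix.map_mul`, `Matrix.transpose_mul`,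
`Matrix.mul_kronecker_mul`, `Matrix.GeneralLinearGroup.map`, `MulAut.conj`, `LinearEquiv.mul_apply / coe_inv`.
Tree: `UnitaryGroupSymplecticEmbedding` (`IsQuadraticCoordinates.resAut`, `resAut_reIm`, `resAut_apply_mk`,
`hermForm`, `im_hermForm_map`, `toSymplectic`, `kroneckerGL`, `dualPair`, `kronecker_map`, `kronecker_transpose`),
`UnitaryGroupSymplecticCarriers` (`symplecticGroupCongr`, `isQuadraticCoordinates_rat`, `adele_re/im_algebraMap`),
`QuadraticRestrictionOfScalars` (`isQuadraticCoordinates_adele`), `UnitaryGroupAutomorphicRep` (`unitaryGroupOfForm`,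
`adelic`, `adelicForm`, `conjAdele`, `algebraMap_conj`), `UnitaryGroupSymplecticCarriers` (`adelicForm_eq_map_map`,
`adelicDualPairToSymplectic`), `UnitaryGroupDualPairCarriers` (`pairToSymplectic`, `adelicPairToSymplectic`),
`UnitaryGroupSymplecticRationalPoints` (`SpTransport.eq_transportSp_mapHom_untransportSp`, `isUnit_det_kronecker`),
`HeisenbergGroup/SymplecticMatrixTransport` (`transportSp`, `mapHom`).

## Provenance

Written under the LEAN-IN-TREE rule (2026-08-18) for the pub-hodgecm formalisation cell (model-construction sub-cell,
node W2-⊗ «(34)-TRANSPORT», leaf C-β).  Nothing in this file is a claim of the manuscripts adjudicated by that cell;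
every property is proved in the kernel.

## References

* A. Weil, Sur certains groupes d'opérateurs unitaires, Acta Math. 111 (1964) [Weil1964].
* S. Kudla, Seesaw dual reductive pairs, Progr. Math. 46 (1984) 244–268, §1 [Kudla1984].
* C. Mœglin, M.-F. Vignéras, J.-L. Waldspurger, *Correspondances de Howe sur un corps p-adique*, LNM 1291 (1987),
  Ch. 1 [MoeglinVignerasWaldspurger1987].
* S. Gelbart, J. Rogawski, L-functions and Fourier–Jacobi coefficients for the unitary group U(3), Invent. Math. 105
  (1991), §3 [GelbartRogawski1991].
-/

set_option autoImplicit false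

noncomputable section

open Matrix NumberField
open scoped Kronecker
open Literature.RepresentationTheory.HeisenbergGroup

namespace Literature.NumberTheory.Automorphic

namespace UnitaryGroup

variable {R S : Type*} [CommRing R] [CommRing S]

/-! ## 1. Isometries between two hermitian form matrices on the same `Sⁿ` -/

section Isometry

variable {n : Type*} [Fintype n] [DecidableEq n]

omit [DecidableEq n] in
/-- **An isometry carries one hermitian pairing to the other**: `(σ g)ᵀ H g = H′ ⇒ h_H(g x, g y) = h_{H′}(x, y)`
(the two-form version of `hermForm_mulVec`). [folklore] -/
theorem hermForm_mulVec_of_isometry (σ : S →+* S) {H H' g : Matrix n n S} (hg : (g.map σ)ᵀ * H * g = H')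
    (x y : n → S) : hermForm σ H (g *ᵥ x) (g *ᵥ y) = hermForm σ H' x y := by
  have h1 : (⇑σ ∘ (g *ᵥ x)) = g.map σ *ᵥ (⇑σ ∘ x) := funext fun i => RingHom.map_mulVec σ g x i
  rw [hermForm_apply, hermForm_apply, h1]
  calc (g.map σ *ᵥ (⇑σ ∘ x)) ⬝ᵥ (H *ᵥ (g *ᵥ y))
      = (((⇑σ ∘ x) ᵥ* (g.map σ)ᵀ) ᵥ* H ᵥ* g) ⬝ᵥ y := by
        rw [Matrix.vecMul_transpose, Matrix.dotProduct_mulVec, Matrix.dotProduct_mulVec]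
    _ = ((⇑σ ∘ x) ᵥ* ((g.map σ)ᵀ * H * g)) ⬝ᵥ y := by rw [Matrix.vecMul_vecMul, Matrix.vecMul_vecMul, Matrix.mul_assoc]
    _ = (⇑σ ∘ x) ⬝ᵥ (H' *ᵥ y) := by rw [hg, Matrix.dotProduct_mulVec]

omit [DecidableEq n] in
/-- Isometries compose: `a : H → H′`, `b : H′ → H″` give `a b : H → H″` (`x ↦ a (b x)`). [folklore] -/
theorem isometry_mul (σ : S →+* S) {H H' H'' a b : Matrix n n S} (ha : (a.map σ)ᵀ * H * a = H')
    (hb : (b.map σ)ᵀ * H' * b = H'') : ((a * b).map σ)ᵀ * H * (a * b) = H'' := by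
  rw [Matrix.map_mul, Matrix.transpose_mul, ← hb, ← ha]
  simp only [Matrix.mul_assoc]

/-- The inverse of an invertible isometry `g : H → H′` is an isometry `H′ → H`. [folklore] -/
theorem isometry_inv (σ : S →+* S) {H H' : Matrix n n S} (g : GL n S)
    (hg : ((g : Matrix n n S).map σ)ᵀ * H * g = H') :
    (((g⁻¹ : GL n S) : Matrix n n S).map σ)ᵀ * H' * ((g⁻¹ : GL n S) : Matrix n n S) = H := by
  have h1 : (g : Matrix n n S).map σ * ((g⁻¹ : GL n S) : Matrix n n S).map σ = 1 := by
    rw [← Matrix.map_mul, ← Units.val_mul, mul_inv_cancel, Units.val_one, Matrix.map_one σ (map_zero σ) (map_one σ)]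
  have h2 : (g : Matrix n n S) * ((g⁻¹ : GL n S) : Matrix n n S) = 1 := by
    rw [← Units.val_mul, mul_inv_cancel, Units.val_one]
  calc (((g⁻¹ : GL n S) : Matrix n n S).map σ)ᵀ * H' * ((g⁻¹ : GL n S) : Matrix n n S)
      = (((g⁻¹ : GL n S) : Matrix n n S).map σ)ᵀ * (((g : Matrix n n S).map σ)ᵀ * H * g) *
          ((g⁻¹ : GL n S) : Matrix n n S) := by rw [hg]
    _ = ((g : Matrix n n S).map σ * ((g⁻¹ : GL n S) : Matrix n n S).map σ)ᵀ * H *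
          ((g : Matrix n n S) * ((g⁻¹ : GL n S) : Matrix n n S)) := by
        rw [Matrix.transpose_mul]
        simp only [Matrix.mul_assoc]
    _ = H := by rw [h1, h2, Matrix.transpose_one, Matrix.one_mul, Matrix.mul_one]

/-- **Conjugation by an isometry `g : (V, h′) ≅ (V, h)` carries `U(σ, H′)` into `U(σ, H)`**: `u′ ↦ g u′ g⁻¹`.
[folklore] -/
theorem conj_mem_unitaryGroupOfForm_of_isometry (σ : S →+* S) {H H' : Matrix n n S} (g : GL n S)
    (hg : ((g : Matrix n n S).map σ)ᵀ * H * g = H') {u : GL n S} (hu : u ∈ unitaryGroupOfForm σ H') :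
    g * u * g⁻¹ ∈ unitaryGroupOfForm σ H := by
  rw [mem_unitaryGroupOfForm_iff] at hu ⊢
  rw [Units.val_mul, Units.val_mul]
  exact isometry_mul σ (isometry_mul σ hg hu) (isometry_inv σ g hg)

/-- **`isometryConj g : U(σ, H′) →* U(σ, H)`, `u′ ↦ g u′ g⁻¹`** for an isometry `g`, `(σ g)ᵀ H g = H′` (restriction of
`MulAut.conj g`). [folklore] -/
def isometryConj (σ : S →+* S) {H H' : Matrix n n S} (g : GL n S)
    (hg : ((g : Matrix n n S).map σ)ᵀ * H * g = H') : unitaryGroupOfForm σ H' →* unitaryGroupOfForm σ H :=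
  (((MulAut.conj g).toMonoidHom).restrict (unitaryGroupOfForm σ H')).codRestrict _
    fun u => conj_mem_unitaryGroupOfForm_of_isometry σ g hg u.2

/-- `isometryConj g u′ = g u′ g⁻¹` in `GLₙ(S)`. [folklore] -/
@[simp] theorem coe_isometryConj (σ : S →+* S) {H H' : Matrix n n S} (g : GL n S)
    (hg : ((g : Matrix n n S).map σ)ᵀ * H * g = H') (u : unitaryGroupOfForm σ H') :
    ((isometryConj σ g hg u : unitaryGroupOfForm σ H) : GL n S) = g * u * g⁻¹ := rfl

/-- `isometryConj g` is injective. [folklore] -/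
theorem isometryConj_injective (σ : S →+* S) {H H' : Matrix n n S} (g : GL n S)
    (hg : ((g : Matrix n n S).map σ)ᵀ * H * g = H') : Function.Injective (isometryConj σ g hg) := fun _ _ huv =>
  Subtype.ext ((MulAut.conj g).injective (congrArg (fun w : unitaryGroupOfForm σ H => (w : GL n S)) huv))

end Isometry

/-! ## 2. The relabelling `Λ_C` and the element `seesawConj g C = Res(g) ∘ Λ_C⁻¹ ∈ Sp(W_T)` -/

section Relabel

variable {n : Type*} [Fintype n] [DecidableEq n]

/-- **The relabelling `Λ_C : (x, y) ↦ (x, C y)` of `W = Rⁿ × Rⁿ`** for `C ∈ GLₙ(R)` (inverse `(x, y) ↦ (x, C⁻¹ y)`):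
for `T C = T′` it is an isomorphism `(W, polar β_{T′}) ≅ (W, polar β_T)` of polarised symplectic spaces.  Same formula
as the adelic `Weil1964/AdelicMetaplecticTransport.relabelVec`, for any commutative ring. [folklore] -/
def relabelEquiv (C : GL n R) : ((n → R) × (n → R)) ≃ₗ[R] ((n → R) × (n → R)) where
  toFun v := (v.1, (C : Matrix n n R) *ᵥ v.2)
  invFun v := (v.1, ((C⁻¹ : GL n R) : Matrix n n R) *ᵥ v.2)
  map_add' v w := Prod.ext rfl (Matrix.mulVec_add _ _ _)
  map_smul' a v := Prod.ext rfl (Matrix.mulVec_smul _ _ _)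
  left_inv v := Prod.ext rfl (by
    show ((C⁻¹ : GL n R) : Matrix n n R) *ᵥ ((C : Matrix n n R) *ᵥ v.2) = v.2
    rw [Matrix.mulVec_mulVec, Units.inv_mul, Matrix.one_mulVec])
  right_inv v := Prod.ext rfl (by
    show (C : Matrix n n R) *ᵥ (((C⁻¹ : GL n R) : Matrix n n R) *ᵥ v.2) = v.2
    rw [Matrix.mulVec_mulVec, Units.mul_inv, Matrix.one_mulVec])

/-- `Λ_C (x, y) = (x, C y)`. [folklore] -/
@[simp] theorem relabelEquiv_apply (C : GL n R) (v : (n → R) × (n → R)) :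
    relabelEquiv C v = (v.1, (C : Matrix n n R) *ᵥ v.2) := rfl

/-- `Λ_C⁻¹ (x, y) = (x, C⁻¹ y)`. [folklore] -/
@[simp] theorem relabelEquiv_symm_apply (C : GL n R) (v : (n → R) × (n → R)) :
    (relabelEquiv C).symm v = (v.1, ((C⁻¹ : GL n R) : Matrix n n R) *ᵥ v.2) := rfl

/-- **`Λ_C` is `polar`-compatible**: `β_T(x, C y′) = x ⬝ᵥ (T C y′) = β_{T′}(x, y′)` for `T C = T′`. [folklore] -/
theorem polar_relabelEquiv (T : Matrix n n R) (C : GL n R) {T' : Matrix n n R} (hC : T * (C : Matrix n n R) = T')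
    (v w : (n → R) × (n → R)) :
    polar (Matrix.toLinearMap₂' R T) (relabelEquiv C v) (relabelEquiv C w) = polar (Matrix.toLinearMap₂' R T') v w := by
  simp only [polar_apply, relabelEquiv_apply, Matrix.toLinearMap₂'_apply']
  rw [Matrix.mulVec_mulVec, hC]

/-- … equivalently for `Λ_C⁻¹`: `polar β_{T′} (Λ_C⁻¹ v) (Λ_C⁻¹ w) = polar β_T v w`. [folklore] -/
theorem polar_relabelEquiv_symm (T : Matrix n n R) (C : GL n R) {T' : Matrix n n R}
    (hC : T * (C : Matrix n n R) = T') (v w : (n → R) × (n → R)) :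
    polar (Matrix.toLinearMap₂' R T') ((relabelEquiv C).symm v) ((relabelEquiv C).symm w) =
      polar (Matrix.toLinearMap₂' R T) v w := by
  rw [← polar_relabelEquiv T C hC, LinearEquiv.apply_symm_apply, LinearEquiv.apply_symm_apply]

/-- On a ring map `f : R →+* R′`, `Λ_{C ⊗ 1}` extends `Λ_C`: `Λ_{GL(f) C} (f ∘ x, f ∘ y) = (f ∘ x, f ∘ (C y))`. [folklore] -/
theorem relabelEquiv_map_apply {R' : Type*} [CommRing R'] (f : R →+* R') (C : GL n R) (v : (n → R) × (n → R)) :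
    relabelEquiv (Matrix.GeneralLinearGroup.map f C) (⇑f ∘ v.1, ⇑f ∘ v.2) =
      (⇑f ∘ (relabelEquiv C v).1, ⇑f ∘ (relabelEquiv C v).2) := by
  refine Prod.ext rfl (funext fun i => ?_)
  simp only [relabelEquiv_apply, Function.comp_apply]
  exact (RingHom.map_mulVec f (C : Matrix n n R) v.2 i).symm

/-- … and so does `Λ_{C ⊗ 1}⁻¹`. [folklore] -/
theorem relabelEquiv_map_symm_apply {R' : Type*} [CommRing R'] (f : R →+* R') (C : GL n R)
    (v : (n → R) × (n → R)) :
    (relabelEquiv (Matrix.GeneralLinearGroup.map f C)).symm (⇑f ∘ v.1, ⇑f ∘ v.2) =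
      (⇑f ∘ ((relabelEquiv C).symm v).1, ⇑f ∘ ((relabelEquiv C).symm v).2) := by
  refine Prod.ext rfl (funext fun i => ?_)
  simp only [relabelEquiv_symm_apply, Function.comp_apply, ← map_inv]
  exact (RingHom.map_mulVec f ((C⁻¹ : GL n R) : Matrix n n R) v.2 i).symm

end Relabel

namespace IsQuadraticCoordinates

open QuadraticCoordinates

variable {φ : R →+* S} {Ψ : (R × R) ≃+ S} {δ : S} {d : R} (h : IsQuadraticCoordinates φ Ψ δ d)
variable (n : Type*) [Fintype n] [DecidableEq n]
include h

/-- **`Res(g)` is a symplectic isomorphism `(W, ⟪ , ⟫_{T′}) ≅ (W, ⟪ , ⟫_T)`** for an isometry `g`, `(σ g)ᵀ H g = H′`,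
`H = T ⊗ 1`, `H′ = T′ ⊗ 1`: `⟪Res(g) v, Res(g) w⟫_T = ⟪v, w⟫_{T′}` with `⟪ , ⟫_T = alt (polar β_T) = im h_T` (it
carries `h′` to `h`, hence `im h′` to `im h`). [cite: MoeglinVignerasWaldspurger1987, Ch. 1 I.17] -/
theorem alt_polar_resAut {T T' : Matrix n n R} (hT : T.IsSymm) (hT' : T'.IsSymm) {σ : S →+* S}
    (hσφ : ∀ a, σ (φ a) = φ a) (hσδ : σ δ = -δ) {H H' : Matrix n n S} (hH : H = T.map φ) (hH' : H' = T'.map φ)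
    {g : GL n S} (hg : ((g : Matrix n n S).map σ)ᵀ * H * g = H') (v w : (n → R) × (n → R)) :
    alt (polar (Matrix.toLinearMap₂' R T)) (h.resAut n g v) (h.resAut n g w) =
      alt (polar (Matrix.toLinearMap₂' R T')) v w := by
  obtain ⟨x, rfl⟩ := (reIm Ψ n).surjective v
  obtain ⟨y, rfl⟩ := (reIm Ψ n).surjective w
  subst hH hH'
  rw [h.resAut_reIm, h.resAut_reIm, ← h.im_hermForm_map n hT hσφ hσδ, ← h.im_hermForm_map n hT' hσφ hσδ,
    hermForm_mulVec_of_isometry σ hg]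

/-- **THE SEE-SAW CONJUGATION ELEMENT `h₀ = Res(g) ∘ Λ_C⁻¹ ∈ Sp(W_T) = symplecticGroup (polar β_T)`** attached to an
isometry `g : (V, h′) ≅ (V, h)` (`(σ g)ᵀ H g = H′`, `H = T ⊗ 1`, `H′ = T′ ⊗ 1`, `T, T′` symmetric) and a relabelling
matrix `C ∈ GLₙ(R)` with `T C = T′`: `Λ_C⁻¹ : (W, ⟪ , ⟫_T) ≅ (W, ⟪ , ⟫_{T′})` (even `polar`-compatibly) and
`Res(g) : (W, ⟪ , ⟫_{T′}) ≅ (W, ⟪ , ⟫_T)`, so the composite preserves `⟪ , ⟫_T`. [cite: Kudla1984, §1] -/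
def seesawConj {T T' : Matrix n n R} (hT : T.IsSymm) (hT' : T'.IsSymm) {σ : S →+* S} (hσφ : ∀ a, σ (φ a) = φ a)
    (hσδ : σ δ = -δ) {H H' : Matrix n n S} (hH : H = T.map φ) (hH' : H' = T'.map φ) (g : GL n S)
    (hg : ((g : Matrix n n S).map σ)ᵀ * H * g = H') (C : GL n R) (hC : T * (C : Matrix n n R) = T') :
    symplecticGroup (polar (Matrix.toLinearMap₂' R T)) :=
  ⟨(relabelEquiv C).symm.trans (h.resAut n g), by
    show _ ∈ Heisenberg.PseudoSymplectic.isometries _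
    rw [Heisenberg.PseudoSymplectic.mem_isometries]
    intro v w
    rw [LinearEquiv.trans_apply, LinearEquiv.trans_apply, h.alt_polar_resAut n hT hT' hσφ hσδ hH hH' hg, alt_apply,
      alt_apply, polar_relabelEquiv_symm T C hC, polar_relabelEquiv_symm T C hC]⟩

/-- `seesawConj g C = Λ_C⁻¹ ≫ Res(g)` as automorphisms of `W`. [folklore] -/
@[simp] theorem coe_seesawConj {T T' : Matrix n n R} (hT : T.IsSymm) (hT' : T'.IsSymm) {σ : S →+* S}
    (hσφ : ∀ a, σ (φ a) = φ a) (hσδ : σ δ = -δ) {H H' : Matrix n n S} (hH : H = T.map φ) (hH' : H' = T'.map φ)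
    (g : GL n S) (hg : ((g : Matrix n n S).map σ)ᵀ * H * g = H') (C : GL n R) (hC : T * (C : Matrix n n R) = T') :
    ((h.seesawConj n hT hT' hσφ hσδ hH hH' g hg C hC : symplecticGroup (polar (Matrix.toLinearMap₂' R T))) :
        ((n → R) × (n → R)) ≃ₗ[R] ((n → R) × (n → R))) = (relabelEquiv C).symm.trans (h.resAut n g) := rfl

/-- `seesawConj g C (x, y) = Res(g) (x, C⁻¹ y)`. [folklore] -/
theorem seesawConj_apply {T T' : Matrix n n R} (hT : T.IsSymm) (hT' : T'.IsSymm) {σ : S →+* S}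
    (hσφ : ∀ a, σ (φ a) = φ a) (hσδ : σ δ = -δ) {H H' : Matrix n n S} (hH : H = T.map φ) (hH' : H' = T'.map φ)
    (g : GL n S) (hg : ((g : Matrix n n S).map σ)ᵀ * H * g = H') (C : GL n R) (hC : T * (C : Matrix n n R) = T')
    (v : (n → R) × (n → R)) :
    (h.seesawConj n hT hT' hσφ hσδ hH hH' g hg C hC).1 v = h.resAut n g (v.1, ((C⁻¹ : GL n R) : Matrix n n R) *ᵥ v.2) :=
  rfl

/-- **Block formula**: with `g = g₁ + g₂ δ` (`g₁ = re ∘ g`, `g₂ = im ∘ g` entrywise),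
`seesawConj g C (a, b) = (g₁ a + d · g₂ C⁻¹ b, g₂ a + g₁ C⁻¹ b)`. [folklore] -/
theorem seesawConj_apply_mk {T T' : Matrix n n R} (hT : T.IsSymm) (hT' : T'.IsSymm) {σ : S →+* S}
    (hσφ : ∀ a, σ (φ a) = φ a) (hσδ : σ δ = -δ) {H H' : Matrix n n S} (hH : H = T.map φ) (hH' : H' = T'.map φ)
    (g : GL n S) (hg : ((g : Matrix n n S).map σ)ᵀ * H * g = H') (C : GL n R) (hC : T * (C : Matrix n n R) = T')
    (a b : n → R) :
    (h.seesawConj n hT hT' hσφ hσδ hH hH' g hg C hC).1 (a, b) =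
      ((g : Matrix n n S).map (re Ψ) *ᵥ a +
          d • ((g : Matrix n n S).map (im Ψ) *ᵥ (((C⁻¹ : GL n R) : Matrix n n R) *ᵥ b)),
        (g : Matrix n n S).map (im Ψ) *ᵥ a +
          (g : Matrix n n S).map (re Ψ) *ᵥ (((C⁻¹ : GL n R) : Matrix n n R) *ᵥ b)) :=
  h.resAut_apply_mk n g a _

/-- **`seesawConj g C ∘ Λ_C = Res(g)`** on `Sⁿ`: `seesawConj g C (Λ_C (reIm x)) = reIm (g x)`. [folklore] -/
theorem seesawConj_relabelEquiv_reIm {T T' : Matrix n n R} (hT : T.IsSymm) (hT' : T'.IsSymm) {σ : S →+* S}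
    (hσφ : ∀ a, σ (φ a) = φ a) (hσδ : σ δ = -δ) {H H' : Matrix n n S} (hH : H = T.map φ) (hH' : H' = T'.map φ)
    (g : GL n S) (hg : ((g : Matrix n n S).map σ)ᵀ * H * g = H') (C : GL n R) (hC : T * (C : Matrix n n R) = T')
    (x : n → S) :
    (h.seesawConj n hT hT' hσφ hσδ hH hH' g hg C hC).1 (relabelEquiv C (reIm Ψ n x)) =
      reIm Ψ n ((g : Matrix n n S) *ᵥ x) := by
  rw [coe_seesawConj, LinearEquiv.trans_apply, LinearEquiv.symm_apply_apply, h.resAut_reIm]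

/-! ## 3. The see-saw square: `h₀ · (Λ_C ι′(u′) Λ_C⁻¹) · h₀⁻¹ = ι(g u′ g⁻¹)` -/

/-- **THE SEE-SAW CONJUGATION SQUARE.** For `u′ ∈ U(σ, H′)` and `h₀ = seesawConj g C`:
`h₀ · (Λ_C ∘ ι′(u′) ∘ Λ_C⁻¹) · h₀⁻¹ = ι(g u′ g⁻¹)` in `Sp(W_T)`, where `ι = toSymplectic … hH`,
`ι′ = toSymplectic … hH′`, `Λ_C ∘ · ∘ Λ_C⁻¹ = symplecticGroupCongr Λ_C` and `g u′ g⁻¹ = isometryConj g u′`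
(`Res` is multiplicative: `Res(g) Λ_C⁻¹ Λ_C Res(u′) Λ_C⁻¹ Λ_C Res(g)⁻¹ = Res(g u′ g⁻¹)`). [cite: Kudla1984, §1] -/
theorem seesawConj_conj_toSymplectic {T T' : Matrix n n R} (hT : T.IsSymm) (hT' : T'.IsSymm) {σ : S →+* S}
    (hσφ : ∀ a, σ (φ a) = φ a) (hσδ : σ δ = -δ) {H H' : Matrix n n S} (hH : H = T.map φ) (hH' : H' = T'.map φ)
    (g : GL n S) (hg : ((g : Matrix n n S).map σ)ᵀ * H * g = H') (C : GL n R) (hC : T * (C : Matrix n n R) = T')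
    (u : unitaryGroupOfForm σ H') :
    h.seesawConj n hT hT' hσφ hσδ hH hH' g hg C hC *
        symplecticGroupCongr _ _ (relabelEquiv C) (polar_relabelEquiv T C hC) (h.toSymplectic n hT' hσφ hσδ hH' u) *
      (h.seesawConj n hT hT' hσφ hσδ hH hH' g hg C hC)⁻¹ =
    h.toSymplectic n hT hσφ hσδ hH (isometryConj σ g hg u) := by
  refine Subtype.ext (LinearEquiv.ext fun v => ?_)
  have hinv : ∀ w, (h.resAut n g).symm w = h.resAut n g⁻¹ w := fun w => by rw [map_inv, LinearEquiv.coe_inv]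
  simp only [Subgroup.coe_mul, Subgroup.coe_inv, LinearEquiv.mul_apply, LinearEquiv.coe_inv, coe_seesawConj,
    LinearEquiv.trans_apply, LinearEquiv.symm_trans_apply, LinearEquiv.symm_symm, coe_symplecticGroupCongr_apply,
    LinearEquiv.symm_apply_apply, coe_toSymplectic, coe_isometryConj, map_mul, hinv]

/-- The same square as an identity of homomorphisms `U(σ, H′) →* Sp(W_T)`:
`conj(h₀) ∘ symplecticGroupCongr Λ_C ∘ ι′ = ι ∘ isometryConj g`. [cite: Kudla1984, §1] -/
theorem conj_seesawConj_comp {T T' : Matrix n n R} (hT : T.IsSymm) (hT' : T'.IsSymm) {σ : S →+* S}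
    (hσφ : ∀ a, σ (φ a) = φ a) (hσδ : σ δ = -δ) {H H' : Matrix n n S} (hH : H = T.map φ) (hH' : H' = T'.map φ)
    (g : GL n S) (hg : ((g : Matrix n n S).map σ)ᵀ * H * g = H') (C : GL n R) (hC : T * (C : Matrix n n R) = T') :
    ((MulAut.conj (h.seesawConj n hT hT' hσφ hσδ hH hH' g hg C hC)).toMonoidHom.comp
        ((symplecticGroupCongr _ _ (relabelEquiv C) (polar_relabelEquiv T C hC)).comp
          (h.toSymplectic n hT' hσφ hσδ hH'))) =
      (h.toSymplectic n hT hσφ hσδ hH).comp (isometryConj σ g hg) :=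
  MonoidHom.ext fun u => h.seesawConj_conj_toSymplectic n hT hT' hσφ hσδ hH hH' g hg C hC u

end IsQuadraticCoordinates

/-! ## 4. The Kronecker instance: `g ↦ 1_V ⊗ g`, `v ⊗ u′ ↦ v ⊗ (g u′ g⁻¹)` -/

section Kronecker

variable {n m : Type*} [Fintype n] [Fintype m]

/-- **Isometries tensor**: `a : H_V → H_V′` and `g : H_W → H_W′` give `a ⊗ g : H_V ⊗ H_W → H_V′ ⊗ H_W′`
(`(σ(a ⊗ g))ᵀ (H_V ⊗ H_W) (a ⊗ g) = ((σ a)ᵀ H_V a) ⊗ ((σ g)ᵀ H_W g)`, mixed-product rule). [cite: MoeglinVignerasWaldspurger1987, Ch. 1 I.17] -/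
theorem kronecker_isometry (σ : S →+* S) {HV HV' a : Matrix n n S} {HW HW' g : Matrix m m S}
    (ha : (a.map σ)ᵀ * HV * a = HV') (hg : (g.map σ)ᵀ * HW * g = HW') :
    ((a ⊗ₖ g).map σ)ᵀ * (HV ⊗ₖ HW) * (a ⊗ₖ g) = HV' ⊗ₖ HW' := by
  rw [kronecker_map, kronecker_transpose, ← Matrix.mul_kronecker_mul, ← Matrix.mul_kronecker_mul, ha, hg]

variable [DecidableEq n] [DecidableEq m]

/-- The identity is an isometry `H → H`. [folklore] -/
theorem one_isometry (σ : S →+* S) (H : Matrix n n S) : ((1 : Matrix n n S).map σ)ᵀ * H * 1 = H := by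
  rw [Matrix.map_one σ (map_zero σ) (map_one σ), Matrix.transpose_one, Matrix.one_mul, Matrix.mul_one]

/-- **`1_V ⊗ g` is an isometry `H_V ⊗ H_W → H_V ⊗ H_W′`** for an isometry `g : H_W → H_W′` (the model
`V ⊗ (W₃ ⊕ W₄) ≅ V ⊗ W` of the see-saw). [cite: Kudla1984, §1] -/
theorem kroneckerGL_one_isometry (σ : S →+* S) (HV : Matrix n n S) {HW HW' : Matrix m m S} (g : GL m S)
    (hg : ((g : Matrix m m S).map σ)ᵀ * HW * g = HW') :
    (((kroneckerGL ((1 : GL n S), g) : GL (n × m) S) : Matrix (n × m) (n × m) S).map σ)ᵀ * (HV ⊗ₖ HW) *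
        ((kroneckerGL ((1 : GL n S), g) : GL (n × m) S) : Matrix (n × m) (n × m) S) = HV ⊗ₖ HW' := by
  rw [coe_kroneckerGL, Units.val_one]
  exact kronecker_isometry σ (one_isometry σ HV) hg

/-- **Mixed-product conjugation**: `(1 ⊗ g) (v ⊗ u) (1 ⊗ g)⁻¹ = v ⊗ (g u g⁻¹)` in `GL_{n × m}(S)`. [folklore] -/
theorem kroneckerGL_one_conj (g : GL m S) (v : GL n S) (u : GL m S) :
    kroneckerGL ((1 : GL n S), g) * kroneckerGL (v, u) * (kroneckerGL ((1 : GL n S), g))⁻¹ =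
      kroneckerGL (v, g * u * g⁻¹) := by
  rw [← map_inv, ← map_mul, ← map_mul, Prod.inv_mk, inv_one, Prod.mk_mul_mk, Prod.mk_mul_mk, one_mul, mul_one]

/-- **`isometryConj (1 ⊗ g) (v ⊗ u′) = v ⊗ isometryConj g u′`**: conjugation by `1 ⊗ g` fixes the first member of the
dual pair and conjugates the second. [cite: Kudla1984, §1] -/
theorem isometryConj_kroneckerGL_dualPair (σ : S →+* S) (HV : Matrix n n S) {HW HW' : Matrix m m S} (g : GL m S)
    (hg : ((g : Matrix m m S).map σ)ᵀ * HW * g = HW') (v : unitaryGroupOfForm σ HV) (u : unitaryGroupOfForm σ HW') :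
    isometryConj σ (kroneckerGL ((1 : GL n S), g)) (kroneckerGL_one_isometry σ HV g hg) (dualPair σ HV HW' (v, u)) =
      dualPair σ HV HW (v, isometryConj σ g hg u) :=
  Subtype.ext (kroneckerGL_one_conj g (v : GL n S) (u : GL m S))

variable {φ : R →+* S} {Ψ : (R × R) ≃+ S} {δ : S} {d : R}

/-- **THE SEE-SAW SQUARE FOR THE DUAL PAIR.** With `h₀ = seesawConj (1_V ⊗ g) C` (`g : H_W → H_W′` an isometry,
`(T_V ⊗ T_W) C = T_V ⊗ T_W′`), `ι = pairToSymplectic : U(σ, H_V ⊗ H_W) →* Sp(W_{T_V ⊗ T_W})` and `ι′` likewise for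
`H_W′`: `h₀ · (Λ_C ι′(v ⊗ u′) Λ_C⁻¹) · h₀⁻¹ = ι(v ⊗ g u′ g⁻¹)` — the first member `U(σ, H_V)` is carried identically,
the second is conjugated by `g`. [cite: Kudla1984, §1] -/
theorem IsQuadraticCoordinates.seesawConj_conj_pairToSymplectic (h : IsQuadraticCoordinates φ Ψ δ d)
    {TV : Matrix n n R} {TW TW' : Matrix m m R} (hV : TV.IsSymm) (hW : TW.IsSymm) (hW' : TW'.IsSymm) {σ : S →+* S}
    (hσφ : ∀ a, σ (φ a) = φ a) (hσδ : σ δ = -δ) {HV : Matrix n n S} {HW HW' : Matrix m m S} (hHV : HV = TV.map φ)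
    (hHW : HW = TW.map φ) (hHW' : HW' = TW'.map φ) (g : GL m S) (hg : ((g : Matrix m m S).map σ)ᵀ * HW * g = HW')
    (C : GL (n × m) R) (hC : TV ⊗ₖ TW * (C : Matrix (n × m) (n × m) R) = TV ⊗ₖ TW')
    (v : unitaryGroupOfForm σ HV) (u : unitaryGroupOfForm σ HW') :
    h.seesawConj (n × m) (isSymm_kronecker hV hW) (isSymm_kronecker hV hW') hσφ hσδ
          (show HV ⊗ₖ HW = (TV ⊗ₖ TW).map φ by rw [hHV, hHW, kronecker_map_map])
          (show HV ⊗ₖ HW' = (TV ⊗ₖ TW').map φ by rw [hHV, hHW', kronecker_map_map])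
          (kroneckerGL ((1 : GL n S), g)) (kroneckerGL_one_isometry σ HV g hg) C hC *
        symplecticGroupCongr _ _ (relabelEquiv C) (polar_relabelEquiv _ C hC)
          (h.pairToSymplectic hV hW' hσφ hσδ hHV hHW' (dualPair σ HV HW' (v, u))) *
      (h.seesawConj (n × m) (isSymm_kronecker hV hW) (isSymm_kronecker hV hW') hσφ hσδ
          (show HV ⊗ₖ HW = (TV ⊗ₖ TW).map φ by rw [hHV, hHW, kronecker_map_map])
          (show HV ⊗ₖ HW' = (TV ⊗ₖ TW').map φ by rw [hHV, hHW', kronecker_map_map])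
          (kroneckerGL ((1 : GL n S), g)) (kroneckerGL_one_isometry σ HV g hg) C hC)⁻¹ =
    h.pairToSymplectic hV hW hσφ hσδ hHV hHW (dualPair σ HV HW (v, isometryConj σ g hg u)) := by
  rw [← isometryConj_kroneckerGL_dualPair σ HV g hg v u]
  exact h.seesawConj_conj_toSymplectic (n × m) _ _ hσφ hσδ _ _ _ _ C hC _

end Kronecker

/-! ## 5. Number fields: the adelic `seesawConj` of rational data is an `F`-rational point of `Sp(W_T)(𝔸_F)` -/

section BaseChange

variable {n : Type*} [Fintype n]

/-- **Isometries are preserved by change of rings**: for `f : S →+* S′` with `f ∘ σ = σ′ ∘ f`,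
`(σ g)ᵀ H g = H′ ⇒ (σ′ (f g))ᵀ (f H) (f g) = f H′` (entrywise). [folklore] -/
theorem isometry_map {S' : Type*} [CommRing S'] {σ : S →+* S} {σ' : S' →+* S'} (f : S →+* S')
    (hf : ∀ x, f (σ x) = σ' (f x)) {H H' g : Matrix n n S} (hg : (g.map σ)ᵀ * H * g = H') :
    ((g.map f).map σ')ᵀ * H.map f * g.map f = H'.map f := by
  have hc : (g.map f).map σ' = (g.map σ).map f := by
    rw [Matrix.map_map, Matrix.map_map]
    exact congrArg g.map (funext fun x => (hf x).symm)
  rw [hc, ← Matrix.transpose_map, ← Matrix.map_mul, ← Matrix.map_mul, hg]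

/-- … and reflected by an INJECTIVE change of rings. [folklore] -/
theorem isometry_of_map {S' : Type*} [CommRing S'] {σ : S →+* S} {σ' : S' →+* S'} (f : S →+* S')
    (hf : ∀ x, f (σ x) = σ' (f x)) (hfi : Function.Injective f) {H H' g : Matrix n n S}
    (hg : ((g.map f).map σ')ᵀ * H.map f * g.map f = H'.map f) : (g.map σ)ᵀ * H * g = H' := by
  have hc : (g.map f).map σ' = (g.map σ).map f := by
    rw [Matrix.map_map, Matrix.map_map]
    exact congrArg g.map (funext fun x => (hf x).symm)
  rw [hc, ← Matrix.transpose_map, ← Matrix.map_mul, ← Matrix.map_mul] at hg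
  exact Matrix.map_injective hfi hg

end BaseChange

section NumberField

variable (F E : Type) [Field F] [NumberField F] [Field E] [NumberField E] [Algebra F E] (c : E ≃ₐ[F] E)
variable {ι : Type*}

/-- `(T₀ ⊗_F E) ⊗_E 𝔸_E = (T₀ ⊗_F 𝔸_F) ⊗ 1 ∈ M_ι(𝔸_E)` for an `F`-rational Gram matrix `T₀`. [folklore] -/
theorem map_map_algebraMap_adele (T₀ : Matrix ι ι F) :
    (T₀.map (algebraMap F E)).map (algebraMap E (AdeleRing (𝓞 E) E)) =
      (T₀.map (algebraMap F (AdeleRing (𝓞 F) F))).map (AdeleRing.baseChange F E) := by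
  rw [Matrix.map_map, Matrix.map_map]
  congr 1
  funext t
  simp only [Function.comp_apply, AdeleRing.baseChange_algebraMap]

variable [Fintype ι]

/-- `(T₀ ⊗ 1) (C₀ ⊗ 1) = T₀′ ⊗ 1` over `𝔸_F` iff `T₀ C₀ = T₀′` over `F` — the direction used here. [folklore] -/
theorem mul_eq_of_map_adele {T₀ T₀' C₀ : Matrix ι ι F}
    (hC : T₀.map (algebraMap F (AdeleRing (𝓞 F) F)) * C₀.map (algebraMap F (AdeleRing (𝓞 F) F)) =
      T₀'.map (algebraMap F (AdeleRing (𝓞 F) F))) : T₀ * C₀ = T₀' := by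
  rw [← Matrix.map_mul] at hC
  exact Matrix.map_injective (AdeleRing.algebraMap_injective (𝓞 F) F) hC

/-- **A rational isometry is an adelic isometry**: `(c g₀)ᵀ (T₀ ⊗ 1) g₀ = T₀′ ⊗ 1` over `E` implies the same for
`g₀ ⊗ 1 ∈ GL_ι(𝔸_E)` and the adelic form matrices `(T₀ ⊗ 1) ⊗ 1`, `(T₀′ ⊗ 1) ⊗ 1`. [folklore] -/
theorem isometry_map_adele {T₀ T₀' : Matrix ι ι F} {g₀ : Matrix ι ι E}
    (hg₀ : (g₀.map (c : E →+* E))ᵀ * T₀.map (algebraMap F E) * g₀ = T₀'.map (algebraMap F E)) :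
    ((g₀.map (algebraMap E (AdeleRing (𝓞 E) E))).map (conjAdele F E c))ᵀ *
          (T₀.map (algebraMap F (AdeleRing (𝓞 F) F))).map (AdeleRing.baseChange F E) *
        g₀.map (algebraMap E (AdeleRing (𝓞 E) E)) =
      (T₀'.map (algebraMap F (AdeleRing (𝓞 F) F))).map (AdeleRing.baseChange F E) := by
  rw [← map_map_algebraMap_adele, ← map_map_algebraMap_adele]
  exact isometry_map (algebraMap E (AdeleRing (𝓞 E) E)) (algebraMap_conj F E c) hg₀

/-- … and conversely (`E → 𝔸_E` is injective). [folklore] -/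
theorem isometry_of_map_adele {T₀ T₀' : Matrix ι ι F} {g₀ : Matrix ι ι E}
    (hg : ((g₀.map (algebraMap E (AdeleRing (𝓞 E) E))).map (conjAdele F E c))ᵀ *
          (T₀.map (algebraMap F (AdeleRing (𝓞 F) F))).map (AdeleRing.baseChange F E) *
        g₀.map (algebraMap E (AdeleRing (𝓞 E) E)) =
      (T₀'.map (algebraMap F (AdeleRing (𝓞 F) F))).map (AdeleRing.baseChange F E)) :
    (g₀.map (c : E →+* E))ᵀ * T₀.map (algebraMap F E) * g₀ = T₀'.map (algebraMap F E) := by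
  rw [← map_map_algebraMap_adele, ← map_map_algebraMap_adele] at hg
  exact isometry_of_map (algebraMap E (AdeleRing (𝓞 E) E)) (algebraMap_conj F E c)
    (AdeleRing.algebraMap_injective (𝓞 E) E) hg

variable [DecidableEq ι]

/-- **`Res_𝔸(g₀ ⊗ 1)` extends `Res_F(g₀)` on `F`-rational vectors** (index-generic form of
`UnitaryGroupSymplecticCarriers.adelicToSymplectic_toAdelic_apply`, for ANY `g₀ ∈ GL_ι(E)`): with `g₀ = γ₁ + γ₂ δ`,
both sides are `((γ₁ ⊗ 1) a + d (γ₂ ⊗ 1) b, (γ₂ ⊗ 1) a + (γ₁ ⊗ 1) b)`. [folklore] -/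
theorem resAut_adele_apply_algebraMap [Algebra.IsQuadraticExtension F E] {δ : E} (hcδ : c δ = -δ) (hδ : δ ≠ 0)
    {d : F} (hd : δ * δ = algebraMap F E d) {g : GL ι (AdeleRing (𝓞 E) E)} {g₀ : GL ι E}
    (hgg₀ : (g : Matrix ι ι (AdeleRing (𝓞 E) E)) = ((g₀ : GL ι E) : Matrix ι ι E).map (algebraMap E (AdeleRing (𝓞 E) E)))
    (w : (ι → F) × (ι → F)) :
    (isQuadraticCoordinates_adele E c hcδ hδ hd).resAut ι g
        (⇑(algebraMap F (AdeleRing (𝓞 F) F)) ∘ w.1, ⇑(algebraMap F (AdeleRing (𝓞 F) F)) ∘ w.2) =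
      (⇑(algebraMap F (AdeleRing (𝓞 F) F)) ∘ ((isQuadraticCoordinates_rat E c hcδ hδ hd).resAut ι g₀ w).1,
        ⇑(algebraMap F (AdeleRing (𝓞 F) F)) ∘ ((isQuadraticCoordinates_rat E c hcδ hδ hd).resAut ι g₀ w).2) := by
  obtain ⟨a, b⟩ := w
  have hre : (g : Matrix ι ι (AdeleRing (𝓞 E) E)).map
        (QuadraticCoordinates.re (quadraticAdeleEquiv F E c hcδ hδ).toAddEquiv) =
      (((g₀ : GL ι E) : Matrix ι ι E).map (QuadraticCoordinates.re
        (quadraticRatCoords E (not_mem_range_algebraMap_of_apply_eq_neg E c hcδ hδ)).toAddEquiv)).map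
        (algebraMap F (AdeleRing (𝓞 F) F)) := by
    rw [hgg₀, Matrix.map_map, Matrix.map_map]
    exact congrArg ((g₀ : GL ι E) : Matrix ι ι E).map (funext (adele_re_algebraMap F E c hcδ hδ hd))
  have him : (g : Matrix ι ι (AdeleRing (𝓞 E) E)).map
        (QuadraticCoordinates.im (quadraticAdeleEquiv F E c hcδ hδ).toAddEquiv) =
      (((g₀ : GL ι E) : Matrix ι ι E).map (QuadraticCoordinates.im
        (quadraticRatCoords E (not_mem_range_algebraMap_of_apply_eq_neg E c hcδ hδ)).toAddEquiv)).map
        (algebraMap F (AdeleRing (𝓞 F) F)) := by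
    rw [hgg₀, Matrix.map_map, Matrix.map_map]
    exact congrArg ((g₀ : GL ι E) : Matrix ι ι E).map (funext (adele_im_algebraMap F E c hcδ hδ hd))
  rw [(isQuadraticCoordinates_adele E c hcδ hδ hd).resAut_apply_mk ι g,
    (isQuadraticCoordinates_rat E c hcδ hδ hd).resAut_apply_mk ι g₀, hre, him]
  refine Prod.ext (funext fun i => ?_) (funext fun i => ?_)
  · simp only [Pi.add_apply, Pi.smul_apply, smul_eq_mul, Function.comp_apply, map_add, map_mul, RingHom.map_mulVec]
  · simp only [Pi.add_apply, Function.comp_apply, map_add, RingHom.map_mulVec]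

/-- **The adelic see-saw element of rational data extends the rational one**: for `g = g₀ ⊗ 1`, `C = C₀ ⊗ 1` and
adelic Grams `T = T₀ ⊗ 1`, `T′ = T₀′ ⊗ 1` (equation parameters `hTT₀`, `hT'T₀'`, so that e.g. `T = T_V.map ι ⊗ₖ T_W.map ι`
with `T₀ = T_V ⊗ₖ T_W` feeds in by `kronecker_map_map`), `seesawConj_𝔸 g C (x ⊗ 1, y ⊗ 1) = (seesawConj_F g₀ C₀ (x, y)) ⊗ 1`
on `F`-rational vectors. [folklore] -/
theorem seesawConj_adele_apply_algebraMap [Algebra.IsQuadraticExtension F E] {δ : E} (hcδ : c δ = -δ)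
    (hδ : δ ≠ 0) {d : F} (hd : δ * δ = algebraMap F E d) {T₀ T₀' : Matrix ι ι F} (hT₀ : T₀.IsSymm)
    (hT₀' : T₀'.IsSymm) {T T' : Matrix ι ι (AdeleRing (𝓞 F) F)} (hTT₀ : T = T₀.map (algebraMap F (AdeleRing (𝓞 F) F)))
    (hT'T₀' : T' = T₀'.map (algebraMap F (AdeleRing (𝓞 F) F))) (hTs : T.IsSymm) (hT's : T'.IsSymm)
    {H H' : Matrix ι ι (AdeleRing (𝓞 E) E)} (hH : H = T.map (AdeleRing.baseChange F E))
    (hH' : H' = T'.map (AdeleRing.baseChange F E)) {g : GL ι (AdeleRing (𝓞 E) E)} {g₀ : GL ι E}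
    (hgg₀ : (g : Matrix ι ι (AdeleRing (𝓞 E) E)) = ((g₀ : GL ι E) : Matrix ι ι E).map (algebraMap E (AdeleRing (𝓞 E) E)))
    (hg : ((g : Matrix ι ι (AdeleRing (𝓞 E) E)).map (conjAdele F E c))ᵀ * H * g = H')
    {C : GL ι (AdeleRing (𝓞 F) F)} {C₀ : GL ι F}
    (hCC₀ : (C : Matrix ι ι (AdeleRing (𝓞 F) F)) = ((C₀ : GL ι F) : Matrix ι ι F).map (algebraMap F (AdeleRing (𝓞 F) F)))
    (hC : T * (C : Matrix ι ι (AdeleRing (𝓞 F) F)) = T') (v : (ι → F) × (ι → F)) :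
    ((isQuadraticCoordinates_adele E c hcδ hδ hd).seesawConj ι hTs hT's (σ := conjAdele F E c)
          (fun a => by rw [conjAdele_apply, AdeleRing.smul_baseChange])
          (by rw [← algebraMap_conj, RingHom.coe_coe, hcδ, map_neg]) hH hH' g hg C hC).1
        (⇑(algebraMap F (AdeleRing (𝓞 F) F)) ∘ v.1, ⇑(algebraMap F (AdeleRing (𝓞 F) F)) ∘ v.2) =
      (⇑(algebraMap F (AdeleRing (𝓞 F) F)) ∘
          (((isQuadraticCoordinates_rat E c hcδ hδ hd).seesawConj ι hT₀ hT₀' (σ := (c : E →+* E))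
              (fun a => c.commutes a) hcδ rfl rfl g₀
              (isometry_of_map_adele F E c (by rw [← hgg₀, ← hTT₀, ← hT'T₀', ← hH, ← hH']; exact hg)) C₀
              (mul_eq_of_map_adele F (by rw [← hCC₀, ← hTT₀, ← hT'T₀']; exact hC))).1 v).1,
        ⇑(algebraMap F (AdeleRing (𝓞 F) F)) ∘
          (((isQuadraticCoordinates_rat E c hcδ hδ hd).seesawConj ι hT₀ hT₀' (σ := (c : E →+* E))
              (fun a => c.commutes a) hcδ rfl rfl g₀
              (isometry_of_map_adele F E c (by rw [← hgg₀, ← hTT₀, ← hT'T₀', ← hH, ← hH']; exact hg)) C₀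
              (mul_eq_of_map_adele F (by rw [← hCC₀, ← hTT₀, ← hT'T₀']; exact hC))).1 v).2) := by
  have hCu : C = Matrix.GeneralLinearGroup.map (algebraMap F (AdeleRing (𝓞 F) F)) C₀ := Units.ext hCC₀
  rw [IsQuadraticCoordinates.seesawConj_apply, IsQuadraticCoordinates.seesawConj_apply]
  have h2 : (((⇑(algebraMap F (AdeleRing (𝓞 F) F)) ∘ v.1, ⇑(algebraMap F (AdeleRing (𝓞 F) F)) ∘ v.2).1,
      ((C⁻¹ : GL ι (AdeleRing (𝓞 F) F)) : Matrix ι ι (AdeleRing (𝓞 F) F)) *ᵥ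
        (⇑(algebraMap F (AdeleRing (𝓞 F) F)) ∘ v.1, ⇑(algebraMap F (AdeleRing (𝓞 F) F)) ∘ v.2).2) :
        (ι → AdeleRing (𝓞 F) F) × (ι → AdeleRing (𝓞 F) F)) =
      (⇑(algebraMap F (AdeleRing (𝓞 F) F)) ∘ (v.1, ((C₀⁻¹ : GL ι F) : Matrix ι ι F) *ᵥ v.2).1,
        ⇑(algebraMap F (AdeleRing (𝓞 F) F)) ∘ (v.1, ((C₀⁻¹ : GL ι F) : Matrix ι ι F) *ᵥ v.2).2) := by
    rw [hCu]
    exact relabelEquiv_map_symm_apply (algebraMap F (AdeleRing (𝓞 F) F)) C₀ v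
  rw [h2]
  exact resAut_adele_apply_algebraMap F E c hcδ hδ hd hgg₀ _

/-- **`seesawConj_𝔸 g C` is the base change of `seesawConj_F g₀ C₀`**:
`= transportSp T (mapHom ι (untransportSp T₀ (seesawConj_F g₀ C₀)))`, `T = T₀ ⊗ 1`, `ι = algebraMap F 𝔸_F`
(`T₀.det ≠ 0`). [folklore] -/
theorem seesawConj_adele_eq_transportSp [Algebra.IsQuadraticExtension F E] {δ : E} (hcδ : c δ = -δ)
    (hδ : δ ≠ 0) {d : F} (hd : δ * δ = algebraMap F E d) {T₀ T₀' : Matrix ι ι F} (hT₀ : T₀.IsSymm)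
    (hT₀' : T₀'.IsSymm) (hT₀d : IsUnit T₀.det) {T T' : Matrix ι ι (AdeleRing (𝓞 F) F)}
    (hTT₀ : T = T₀.map (algebraMap F (AdeleRing (𝓞 F) F))) (hT'T₀' : T' = T₀'.map (algebraMap F (AdeleRing (𝓞 F) F)))
    (hTs : T.IsSymm) (hT's : T'.IsSymm) (hT : IsUnit T.det) {H H' : Matrix ι ι (AdeleRing (𝓞 E) E)}
    (hH : H = T.map (AdeleRing.baseChange F E)) (hH' : H' = T'.map (AdeleRing.baseChange F E))
    {g : GL ι (AdeleRing (𝓞 E) E)} {g₀ : GL ι E}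
    (hgg₀ : (g : Matrix ι ι (AdeleRing (𝓞 E) E)) = ((g₀ : GL ι E) : Matrix ι ι E).map (algebraMap E (AdeleRing (𝓞 E) E)))
    (hg : ((g : Matrix ι ι (AdeleRing (𝓞 E) E)).map (conjAdele F E c))ᵀ * H * g = H')
    {C : GL ι (AdeleRing (𝓞 F) F)} {C₀ : GL ι F}
    (hCC₀ : (C : Matrix ι ι (AdeleRing (𝓞 F) F)) = ((C₀ : GL ι F) : Matrix ι ι F).map (algebraMap F (AdeleRing (𝓞 F) F)))
    (hC : T * (C : Matrix ι ι (AdeleRing (𝓞 F) F)) = T') :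
    (isQuadraticCoordinates_adele E c hcδ hδ hd).seesawConj ι hTs hT's (σ := conjAdele F E c)
          (fun a => by rw [conjAdele_apply, AdeleRing.smul_baseChange])
          (by rw [← algebraMap_conj, RingHom.coe_coe, hcδ, map_neg]) hH hH' g hg C hC =
      SymplecticMatrix.transportSp T hT
        (SymplecticMatrix.mapHom (algebraMap F (AdeleRing (𝓞 F) F))
          (SpTransport.untransportSp T₀ hT₀d
            ((isQuadraticCoordinates_rat E c hcδ hδ hd).seesawConj ι hT₀ hT₀' (σ := (c : E →+* E))
              (fun a => c.commutes a) hcδ rfl rfl g₀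
              (isometry_of_map_adele F E c (by rw [← hgg₀, ← hTT₀, ← hT'T₀', ← hH, ← hH']; exact hg)) C₀
              (mul_eq_of_map_adele F (by rw [← hCC₀, ← hTT₀, ← hT'T₀']; exact hC))))) :=
  SpTransport.eq_transportSp_mapHom_untransportSp T₀ hT₀d (algebraMap F (AdeleRing (𝓞 F) F)) _ hT hTT₀ _ _
    (seesawConj_adele_apply_algebraMap F E c hcδ hδ hd hT₀ hT₀' hTT₀ hT'T₀' hTs hT's hH hH' hgg₀ hg hCC₀ hC)

/-- **THE SEE-SAW ELEMENT OF RATIONAL DATA IS AN `F`-RATIONAL POINT OF `Sp(W_T)(𝔸_F)`**: for `F`-rational symmetric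
`T₀, T₀′` (`det T₀ ≠ 0`), adelic Grams `T = T₀ ⊗ 1`, `T′ = T₀′ ⊗ 1`, an isometry `g = g₀ ⊗ 1`, `g₀ ∈ GL_ι(E)`,
between the adelic hermitian forms `H = T ⊗ 1`, `H′ = T′ ⊗ 1` over `𝔸_E`, and a relabelling `C = C₀ ⊗ 1`,
`C₀ ∈ GL_ι(F)`, `T C = T′`:  `seesawConj g C ∈ ((transportSp T hT).comp (mapHom ι)).range`, `ι = algebraMap F 𝔸_F`
— the rational points of record of `UnitaryGroupSymplecticRationalPoints` (cf. `ι_𝔸(U(J)(F)) ⊆ Sp_F(W)`,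
[GelbartRogawski1991, §3.1 p. 455]); the one hypothesis Weil's `Θ`-fixing rational lift
[Weil1964, Chap. III n° 41 Thm 6 p. 193] consumes (coefficientwise base change of the block formula). [folklore] -/
theorem seesawConj_adele_mem_range [Algebra.IsQuadraticExtension F E] {δ : E} (hcδ : c δ = -δ)
    (hδ : δ ≠ 0) {d : F} (hd : δ * δ = algebraMap F E d) {T₀ T₀' : Matrix ι ι F} (hT₀ : T₀.IsSymm)
    (hT₀' : T₀'.IsSymm) (hT₀d : IsUnit T₀.det) {T T' : Matrix ι ι (AdeleRing (𝓞 F) F)}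
    (hTT₀ : T = T₀.map (algebraMap F (AdeleRing (𝓞 F) F))) (hT'T₀' : T' = T₀'.map (algebraMap F (AdeleRing (𝓞 F) F)))
    (hTs : T.IsSymm) (hT's : T'.IsSymm) (hT : IsUnit T.det) {H H' : Matrix ι ι (AdeleRing (𝓞 E) E)}
    (hH : H = T.map (AdeleRing.baseChange F E)) (hH' : H' = T'.map (AdeleRing.baseChange F E))
    {g : GL ι (AdeleRing (𝓞 E) E)} {g₀ : GL ι E}
    (hgg₀ : (g : Matrix ι ι (AdeleRing (𝓞 E) E)) = ((g₀ : GL ι E) : Matrix ι ι E).map (algebraMap E (AdeleRing (𝓞 E) E)))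
    (hg : ((g : Matrix ι ι (AdeleRing (𝓞 E) E)).map (conjAdele F E c))ᵀ * H * g = H')
    {C : GL ι (AdeleRing (𝓞 F) F)} {C₀ : GL ι F}
    (hCC₀ : (C : Matrix ι ι (AdeleRing (𝓞 F) F)) = ((C₀ : GL ι F) : Matrix ι ι F).map (algebraMap F (AdeleRing (𝓞 F) F)))
    (hC : T * (C : Matrix ι ι (AdeleRing (𝓞 F) F)) = T') :
    (isQuadraticCoordinates_adele E c hcδ hδ hd).seesawConj ι hTs hT's (σ := conjAdele F E c)
          (fun a => by rw [conjAdele_apply, AdeleRing.smul_baseChange])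
          (by rw [← algebraMap_conj, RingHom.coe_coe, hcδ, map_neg]) hH hH' g hg C hC ∈
      ((SymplecticMatrix.transportSp T hT).comp (SymplecticMatrix.mapHom (algebraMap F (AdeleRing (𝓞 F) F)))).range :=
  ⟨_, (seesawConj_adele_eq_transportSp F E c hcδ hδ hd hT₀ hT₀' hT₀d hTT₀ hT'T₀' hTs hT's hT hH hH' hgg₀ hg
    hCC₀ hC).symm⟩

end NumberField

/-! ## 6. The adelic unitary dual pair `U(J_V) × U(J_W)`: `h₀ = seesawConj (1 ⊗ g) C` in the carriers' vocabulary -/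

section DualPairAdelic

variable (F E : Type) [Field F] [NumberField F] [Field E] [NumberField E] [Algebra F E] (c : E ≃ₐ[F] E) (N M : ℕ)

/-- **`u′ ↦ g u′ g⁻¹ : U(J_W′)(𝔸_F) →* U(J_W)(𝔸_F)`** for an adelic isometry `g ∈ GL_M(𝔸_E)`,
`(c g)ᵀ (J_W ⊗ 1) g = J_W′ ⊗ 1` (`isometryConj` in the vocabulary of `UnitaryGroupAutomorphicRep.adelic`).
[cite: Kudla1984, §1] -/
def adelicIsometryConj {JW JW' : Matrix (Fin M) (Fin M) E} (g : GL (Fin M) (AdeleRing (𝓞 E) E))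
    (hg : ((g : Matrix (Fin M) (Fin M) (AdeleRing (𝓞 E) E)).map (conjAdele F E c))ᵀ * adelicForm E M JW * g =
      adelicForm E M JW') : adelic F E c M JW' →* adelic F E c M JW :=
  isometryConj (conjAdele F E c) g hg

omit [NumberField F] in
/-- `adelicIsometryConj g u′ = g u′ g⁻¹`. [folklore] -/
@[simp] theorem coe_adelicIsometryConj {JW JW' : Matrix (Fin M) (Fin M) E} (g : GL (Fin M) (AdeleRing (𝓞 E) E))
    (hg : ((g : Matrix (Fin M) (Fin M) (AdeleRing (𝓞 E) E)).map (conjAdele F E c))ᵀ * adelicForm E M JW * g =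
      adelicForm E M JW') (u : adelic F E c M JW') :
    ((adelicIsometryConj F E c M g hg u : adelic F E c M JW) : GL (Fin M) (AdeleRing (𝓞 E) E)) = g * u * g⁻¹ := rfl

/-- **THE ADELIC SEE-SAW ELEMENT `h₀ = seesawConj (1_V ⊗ g) C ∈ Sp(𝕎_{T_V ⊗ T_W})(𝔸_F)`** of the unitary dual pair
`U(J_V) × U(J_W)`, `J_V = T_V ⊗ 1`, `J_W = T_W ⊗ 1`, `J_W′ = T_W′ ⊗ 1`: `g : (W ⊗ 𝔸, J_W′) ≅ (W ⊗ 𝔸, J_W)` an adelic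
isometry and `C ∈ GL_{N M}(𝔸_F)` with `(T_V ⊗ T_W ⊗ 1) C = T_V ⊗ T_W′ ⊗ 1` — an element of the SAME symplectic group as
the images of `adelicDualPairToSymplectic` / `adelicPairToSymplectic` (`UnitaryGroupSymplecticCarriers`,
`UnitaryGroupDualPairCarriers`). [cite: Kudla1984, §1] -/
def adelicSeesawConj [Algebra.IsQuadraticExtension F E] {δ : E} (hcδ : c δ = -δ) (hδ : δ ≠ 0) {d : F}
    (hd : δ * δ = algebraMap F E d) {TV : Matrix (Fin N) (Fin N) F} {TW TW' : Matrix (Fin M) (Fin M) F}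
    (hV : TV.IsSymm) (hW : TW.IsSymm) (hW' : TW'.IsSymm) {JV : Matrix (Fin N) (Fin N) E}
    {JW JW' : Matrix (Fin M) (Fin M) E} (hJV : JV = TV.map (algebraMap F E)) (hJW : JW = TW.map (algebraMap F E))
    (hJW' : JW' = TW'.map (algebraMap F E)) (g : GL (Fin M) (AdeleRing (𝓞 E) E))
    (hg : ((g : Matrix (Fin M) (Fin M) (AdeleRing (𝓞 E) E)).map (conjAdele F E c))ᵀ * adelicForm E M JW * g =
      adelicForm E M JW') (C : GL (Fin N × Fin M) (AdeleRing (𝓞 F) F))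
    (hC : TV.map (algebraMap F (AdeleRing (𝓞 F) F)) ⊗ₖ TW.map (algebraMap F (AdeleRing (𝓞 F) F)) *
        (C : Matrix (Fin N × Fin M) (Fin N × Fin M) (AdeleRing (𝓞 F) F)) =
      TV.map (algebraMap F (AdeleRing (𝓞 F) F)) ⊗ₖ TW'.map (algebraMap F (AdeleRing (𝓞 F) F))) :
    symplecticGroup (polar (Matrix.toLinearMap₂' (AdeleRing (𝓞 F) F)
      (TV.map (algebraMap F (AdeleRing (𝓞 F) F)) ⊗ₖ TW.map (algebraMap F (AdeleRing (𝓞 F) F))))) :=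
  (isQuadraticCoordinates_adele E c hcδ hδ hd).seesawConj (Fin N × Fin M)
    (isSymm_kronecker (hV.map _) (hW.map _)) (isSymm_kronecker (hV.map _) (hW'.map _)) (σ := conjAdele F E c)
    (fun a => by rw [conjAdele_apply, AdeleRing.smul_baseChange])
    (by rw [← algebraMap_conj, RingHom.coe_coe, hcδ, map_neg])
    (H := adelicForm E N JV ⊗ₖ adelicForm E M JW) (H' := adelicForm E N JV ⊗ₖ adelicForm E M JW')
    (by rw [adelicForm_eq_map_map E N TV hJV, adelicForm_eq_map_map E M TW hJW, kronecker_map_map])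
    (by rw [adelicForm_eq_map_map E N TV hJV, adelicForm_eq_map_map E M TW' hJW', kronecker_map_map])
    (kroneckerGL ((1 : GL (Fin N) (AdeleRing (𝓞 E) E)), g))
    (kroneckerGL_one_isometry (conjAdele F E c) (adelicForm E N JV) g hg) C hC

/-- `adelicSeesawConj g C (x, y) = Res(1 ⊗ g) (x, C⁻¹ y)`. [folklore] -/
theorem coe_adelicSeesawConj [Algebra.IsQuadraticExtension F E] {δ : E} (hcδ : c δ = -δ) (hδ : δ ≠ 0) {d : F}
    (hd : δ * δ = algebraMap F E d) {TV : Matrix (Fin N) (Fin N) F} {TW TW' : Matrix (Fin M) (Fin M) F}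
    (hV : TV.IsSymm) (hW : TW.IsSymm) (hW' : TW'.IsSymm) {JV : Matrix (Fin N) (Fin N) E}
    {JW JW' : Matrix (Fin M) (Fin M) E} (hJV : JV = TV.map (algebraMap F E)) (hJW : JW = TW.map (algebraMap F E))
    (hJW' : JW' = TW'.map (algebraMap F E)) (g : GL (Fin M) (AdeleRing (𝓞 E) E))
    (hg : ((g : Matrix (Fin M) (Fin M) (AdeleRing (𝓞 E) E)).map (conjAdele F E c))ᵀ * adelicForm E M JW * g =
      adelicForm E M JW') (C : GL (Fin N × Fin M) (AdeleRing (𝓞 F) F))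
    (hC : TV.map (algebraMap F (AdeleRing (𝓞 F) F)) ⊗ₖ TW.map (algebraMap F (AdeleRing (𝓞 F) F)) *
        (C : Matrix (Fin N × Fin M) (Fin N × Fin M) (AdeleRing (𝓞 F) F)) =
      TV.map (algebraMap F (AdeleRing (𝓞 F) F)) ⊗ₖ TW'.map (algebraMap F (AdeleRing (𝓞 F) F))) :
    ((adelicSeesawConj F E c N M hcδ hδ hd hV hW hW' hJV hJW hJW' g hg C hC : symplecticGroup _) :
        ((Fin N × Fin M → AdeleRing (𝓞 F) F) × (Fin N × Fin M → AdeleRing (𝓞 F) F)) ≃ₗ[AdeleRing (𝓞 F) F]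
          ((Fin N × Fin M → AdeleRing (𝓞 F) F) × (Fin N × Fin M → AdeleRing (𝓞 F) F))) =
      (relabelEquiv C).symm.trans
        ((isQuadraticCoordinates_adele E c hcδ hδ hd).resAut (Fin N × Fin M)
          (kroneckerGL ((1 : GL (Fin N) (AdeleRing (𝓞 E) E)), g))) :=
  rfl

/-- **THE ADELIC SEE-SAW SQUARE**: for `v ∈ U(J_V)(𝔸_F)`, `u′ ∈ U(J_W′)(𝔸_F)` and `h₀ = adelicSeesawConj g C`,
`h₀ · (Λ_C toSp′(v ⊗ u′) Λ_C⁻¹) · h₀⁻¹ = toSp(v ⊗ g u′ g⁻¹)`, `toSp = adelicPairToSymplectic … hJW`,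
`toSp′ = adelicPairToSymplectic … hJW′` — conjugation by `h₀` fixes the `U(J_V)`-member and conjugates the
`U(J_W)`-member of the dual pair. [cite: Kudla1984, §1] -/
theorem adelicSeesawConj_conj [Algebra.IsQuadraticExtension F E] {δ : E} (hcδ : c δ = -δ) (hδ : δ ≠ 0) {d : F}
    (hd : δ * δ = algebraMap F E d) {TV : Matrix (Fin N) (Fin N) F} {TW TW' : Matrix (Fin M) (Fin M) F}
    (hV : TV.IsSymm) (hW : TW.IsSymm) (hW' : TW'.IsSymm) {JV : Matrix (Fin N) (Fin N) E}
    {JW JW' : Matrix (Fin M) (Fin M) E} (hJV : JV = TV.map (algebraMap F E)) (hJW : JW = TW.map (algebraMap F E))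
    (hJW' : JW' = TW'.map (algebraMap F E)) (g : GL (Fin M) (AdeleRing (𝓞 E) E))
    (hg : ((g : Matrix (Fin M) (Fin M) (AdeleRing (𝓞 E) E)).map (conjAdele F E c))ᵀ * adelicForm E M JW * g =
      adelicForm E M JW') (C : GL (Fin N × Fin M) (AdeleRing (𝓞 F) F))
    (hC : TV.map (algebraMap F (AdeleRing (𝓞 F) F)) ⊗ₖ TW.map (algebraMap F (AdeleRing (𝓞 F) F)) *
        (C : Matrix (Fin N × Fin M) (Fin N × Fin M) (AdeleRing (𝓞 F) F)) =
      TV.map (algebraMap F (AdeleRing (𝓞 F) F)) ⊗ₖ TW'.map (algebraMap F (AdeleRing (𝓞 F) F)))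
    (v : adelic F E c N JV) (u : adelic F E c M JW') :
    adelicSeesawConj F E c N M hcδ hδ hd hV hW hW' hJV hJW hJW' g hg C hC *
        symplecticGroupCongr _ _ (relabelEquiv C) (polar_relabelEquiv _ C hC)
          (adelicPairToSymplectic F E c N M hcδ hδ hd hV hW' hJV hJW'
            (dualPair (conjAdele F E c) (adelicForm E N JV) (adelicForm E M JW') (v, u))) *
      (adelicSeesawConj F E c N M hcδ hδ hd hV hW hW' hJV hJW hJW' g hg C hC)⁻¹ =
    adelicPairToSymplectic F E c N M hcδ hδ hd hV hW hJV hJW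
      (dualPair (conjAdele F E c) (adelicForm E N JV) (adelicForm E M JW) (v, adelicIsometryConj F E c M g hg u)) :=
  (isQuadraticCoordinates_adele E c hcδ hδ hd).seesawConj_conj_pairToSymplectic (hV.map _) (hW.map _) (hW'.map _)
    _ _ (adelicForm_eq_map_map E N TV hJV) (adelicForm_eq_map_map E M TW hJW) (adelicForm_eq_map_map E M TW' hJW')
    g hg C hC v u

/-- The same with `adelicDualPairToSymplectic` (`= adelicPairToSymplectic ∘ dualPair`, `rfl`). [cite: Kudla1984, §1] -/
theorem adelicSeesawConj_conj_dualPair [Algebra.IsQuadraticExtension F E] {δ : E} (hcδ : c δ = -δ) (hδ : δ ≠ 0)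
    {d : F} (hd : δ * δ = algebraMap F E d) {TV : Matrix (Fin N) (Fin N) F} {TW TW' : Matrix (Fin M) (Fin M) F}
    (hV : TV.IsSymm) (hW : TW.IsSymm) (hW' : TW'.IsSymm) {JV : Matrix (Fin N) (Fin N) E}
    {JW JW' : Matrix (Fin M) (Fin M) E} (hJV : JV = TV.map (algebraMap F E)) (hJW : JW = TW.map (algebraMap F E))
    (hJW' : JW' = TW'.map (algebraMap F E)) (g : GL (Fin M) (AdeleRing (𝓞 E) E))
    (hg : ((g : Matrix (Fin M) (Fin M) (AdeleRing (𝓞 E) E)).map (conjAdele F E c))ᵀ * adelicForm E M JW * g =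
      adelicForm E M JW') (C : GL (Fin N × Fin M) (AdeleRing (𝓞 F) F))
    (hC : TV.map (algebraMap F (AdeleRing (𝓞 F) F)) ⊗ₖ TW.map (algebraMap F (AdeleRing (𝓞 F) F)) *
        (C : Matrix (Fin N × Fin M) (Fin N × Fin M) (AdeleRing (𝓞 F) F)) =
      TV.map (algebraMap F (AdeleRing (𝓞 F) F)) ⊗ₖ TW'.map (algebraMap F (AdeleRing (𝓞 F) F)))
    (v : adelic F E c N JV) (u : adelic F E c M JW') :
    adelicSeesawConj F E c N M hcδ hδ hd hV hW hW' hJV hJW hJW' g hg C hC *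
        symplecticGroupCongr _ _ (relabelEquiv C) (polar_relabelEquiv _ C hC)
          (adelicDualPairToSymplectic F E c N M hcδ hδ hd hV hW' hJV hJW' (v, u)) *
      (adelicSeesawConj F E c N M hcδ hδ hd hV hW hW' hJV hJW hJW' g hg C hC)⁻¹ =
    adelicDualPairToSymplectic F E c N M hcδ hδ hd hV hW hJV hJW (v, adelicIsometryConj F E c M g hg u) :=
  adelicSeesawConj_conj F E c N M hcδ hδ hd hV hW hW' hJV hJW hJW' g hg C hC v u

/-- **`h₀ = adelicSeesawConj (g₀ ⊗ 1) (C₀ ⊗ 1)` OF RATIONAL DATA IS `F`-RATIONAL**: for `g = g₀ ⊗ 1` (`g₀ ∈ GL_M(E)`),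
`C = C₀ ⊗ 1` (`C₀ ∈ GL_{N M}(F)`) and `det T_V, det T_W ≠ 0`,
`adelicSeesawConj g C ∈ ((transportSp (T_V.map ι ⊗ₖ T_W.map ι) hT).comp (mapHom ι)).range`, `ι = algebraMap F 𝔸_F` — the
`F`-rational points of `Sp(𝕎)(𝔸_F)` of record (`UnitaryGroupSymplecticRationalPoints`; cf. [GelbartRogawski1991,
§3.1 p. 455]), i.e. exactly the hypothesis of Weil's `Θ`-fixing rational lift [Weil1964, Chap. III n° 41 Thm 6 p. 193]
over the dual pair's symplectic group. [folklore] -/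
theorem adelicSeesawConj_mem_range [Algebra.IsQuadraticExtension F E] {δ : E} (hcδ : c δ = -δ) (hδ : δ ≠ 0)
    {d : F} (hd : δ * δ = algebraMap F E d) {TV : Matrix (Fin N) (Fin N) F} {TW TW' : Matrix (Fin M) (Fin M) F}
    (hV : TV.IsSymm) (hW : TW.IsSymm) (hW' : TW'.IsSymm) (hTVd : IsUnit TV.det) (hTWd : IsUnit TW.det)
    (hT : IsUnit (TV.map (algebraMap F (AdeleRing (𝓞 F) F)) ⊗ₖ TW.map (algebraMap F (AdeleRing (𝓞 F) F))).det)
    {JV : Matrix (Fin N) (Fin N) E} {JW JW' : Matrix (Fin M) (Fin M) E} (hJV : JV = TV.map (algebraMap F E))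
    (hJW : JW = TW.map (algebraMap F E)) (hJW' : JW' = TW'.map (algebraMap F E))
    {g : GL (Fin M) (AdeleRing (𝓞 E) E)} {g₀ : GL (Fin M) E}
    (hgg₀ : (g : Matrix (Fin M) (Fin M) (AdeleRing (𝓞 E) E)) =
      ((g₀ : GL (Fin M) E) : Matrix (Fin M) (Fin M) E).map (algebraMap E (AdeleRing (𝓞 E) E)))
    (hg : ((g : Matrix (Fin M) (Fin M) (AdeleRing (𝓞 E) E)).map (conjAdele F E c))ᵀ * adelicForm E M JW * g =
      adelicForm E M JW') {C : GL (Fin N × Fin M) (AdeleRing (𝓞 F) F)} {C₀ : GL (Fin N × Fin M) F}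
    (hCC₀ : (C : Matrix (Fin N × Fin M) (Fin N × Fin M) (AdeleRing (𝓞 F) F)) =
      ((C₀ : GL (Fin N × Fin M) F) : Matrix (Fin N × Fin M) (Fin N × Fin M) F).map (algebraMap F (AdeleRing (𝓞 F) F)))
    (hC : TV.map (algebraMap F (AdeleRing (𝓞 F) F)) ⊗ₖ TW.map (algebraMap F (AdeleRing (𝓞 F) F)) *
        (C : Matrix (Fin N × Fin M) (Fin N × Fin M) (AdeleRing (𝓞 F) F)) =
      TV.map (algebraMap F (AdeleRing (𝓞 F) F)) ⊗ₖ TW'.map (algebraMap F (AdeleRing (𝓞 F) F))) :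
    adelicSeesawConj F E c N M hcδ hδ hd hV hW hW' hJV hJW hJW' g hg C hC ∈
      ((SymplecticMatrix.transportSp
          (TV.map (algebraMap F (AdeleRing (𝓞 F) F)) ⊗ₖ TW.map (algebraMap F (AdeleRing (𝓞 F) F))) hT).comp
        (SymplecticMatrix.mapHom (algebraMap F (AdeleRing (𝓞 F) F)))).range :=
  seesawConj_adele_mem_range F E c hcδ hδ hd (isSymm_kronecker hV hW) (isSymm_kronecker hV hW')
    (SpTransport.isUnit_det_kronecker hTVd hTWd) (kronecker_map_map _ TV TW) (kronecker_map_map _ TV TW') _ _ hT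
    _ _ (g₀ := kroneckerGL ((1 : GL (Fin N) E), g₀))
    (by
      show ((1 : GL (Fin N) (AdeleRing (𝓞 E) E)) : Matrix (Fin N) (Fin N) (AdeleRing (𝓞 E) E)) ⊗ₖ
          (g : Matrix (Fin M) (Fin M) (AdeleRing (𝓞 E) E)) =
        (((1 : GL (Fin N) E) : Matrix (Fin N) (Fin N) E) ⊗ₖ ((g₀ : GL (Fin M) E) : Matrix (Fin M) (Fin M) E)).map
          (algebraMap E (AdeleRing (𝓞 E) E))
      rw [Units.val_one, Units.val_one, hgg₀, ← Matrix.map_one (algebraMap E (AdeleRing (𝓞 E) E)) (map_zero _)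
        (map_one _), kronecker_map_map])
    _ hCC₀ hC

end DualPairAdelic


end UnitaryGroup

end Literature.NumberTheory.Automorphic

end
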